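import Summits.ResolutionOfSingularities.ResolutionOfSingularities.Theorems.FrobeniusClosingSteerAutoPermissibleTwo
import HarnessLib

/-!
# Crux `Steer` (stmt-ResolutionOfSingularities-16345), chain W4.1: σ_top LEGALITY BRICKS for the F-B / F-A1 side,
# part 1 of 2 — the words, (L1) auto-equimultiplicity at `p = 2`, (L5) «no two odd boundary components»
# (Theses-free research support; the words are VERBATIM copies of res-L0-w41-lead-1's `Steer_r31.lean`)

OURS (campaign `res-hironaka`, rung L ★L-G4, slot W4.1; statements about the route's own objects; they replace the
role of no printed item and are NOT statements of the manuscript under review [claim: Hironaka2017, status: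
under-review]; AI review is weaker than expert review). Object of res-L0-w41-plan-1 RULING 52 (g9)
(HOME/STATUS 2026-08-27T09:38:21Z) for seat res-D-pv-004 (AS res-L0-w41-stub-10); consumers: res-L0-w41-stub-2
(U8 legality test), res-D-pv-003 (Θ1♭ / F-A), res-L0-w41-idea-1 / idea-3, res-type-054, the holder res-L0-w41-lead-1
(N-σ1 docstring line at r32). Part 2 (`FrobeniusClosingSteerSigmaTopLegalityForest.lean`) has the forest bricks
(L2)–(L4); the split is the 400-line rule.

## Words (§0)

`RadicandRing`, `IsSingPrime`, `IsTopSingComponent`, `IsPermissibleCentre` (`Steer_r31.lean` 727d9e199382098a §σ2,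
l.1373 / 1413 / 1420 / 1431; unchanged in r32 6ccdb6edb3c7f9c9) and the forest words `IsPointStep`, `IsPosStep`,
`IsAncestorStep`, `IsRootStep`, `HasInfiniteBirths` (§σ2.10 / §σ2.25, l.1768 / 3090 / 3096 / 3101 / 3113) are
re-declared VERBATIM in this file's namespace (only the namespace differs), so that the holder bridges by definitional
unfolding.

## (L1) At `p = 2` clause 4 of `IsPermissibleCentre` is implied by clauses 2–3 (§1)

For a field `K` of characteristic `2`, a REGULAR local subring `R ⊆ K`, `f ∈ R` and a prime `P` with `R ⧸ P`
regular: if `T² = f` is singular at `P` (`IsSingPrime R 2 f P`) then `f − g² ∈ P²` for some `g ∈ R`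
(`exists_sub_sq_mem_sq_of_isSingPrime`); hence `IsTopSingComponent R 2 f P ∧ IsRegularLocalRing (R ⧸ P)` imply
`∃ g, f − g ^ 2 ∈ P ^ 2` (`exists_sub_sq_mem_sq_of_isTopSingComponent` — the minimality and max-dimension clauses of
`IsTopSingComponent` are NOT used), and `isPermissibleCentre_two_iff` / `not_exists_isPermissibleCentre_two_iff`
(«σ_top takes the POINT step iff every top singular component `≠ 𝔪` has a SINGULAR quotient»). **The mathematics of
(L1) is already in the tree**: res-type-082's ORDER-β file `FrobeniusClosingSteerAutoPermissibleTwo.lean` (p505361)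
proves it for every prime `p` with conclusion `P²` (criterion at `P` + normality of `R ⧸ P`, Matsumura 19.4, +
`P⁽²⁾ = P²`, Matsumura 16.2 (ii)) and in the literal unfolded `p = 2` form; §1 only RESTATES it over the r31 words
(one-line proofs, credit res-type-082; the same proof is res-L0-w41-tri-3's row R-I (b), TRIAGE.md b0e34873e02bee24).

## (L5) «No two odd boundary components» (§5; res-L0-w41-tri-1 PREREG-FB v1 D·S2, `v66/NoTwoOdd.lean`
23645b43a53db55b, landed here at tri-1's request with tri-1's proofs)

In characteristic `2`: `f ≡ □ (mod xa)`, `f ≡ □ (mod xb)`, `xa` prime, `xa ∤ xb`, `(xa, xb)` radical ⇒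
`f − ga² ∈ (xa)·(xa, xb) ⊆ (xa, xb)²` (`sub_sq_mem_span_mul_span_pair`, `sub_sq_mem_span_pair_sq`); hence, on a regular
local member, `P = (xa, xb)` (prime) is a SINGULAR PRIME of `T² = f` (`isSingPrime_span_pair_of_sq_mod_both`) — two odd
boundary components through a point make their intersection a candidate permissible centre (§1), so σ_top does not
take the point step there. NOT included: tri-1's D·S1 («R₁ at point stages», no kernel text yet).

No Theses file is imported; nothing here is a route item or a registration. [cite: Matsumura1987, Thm. 14.2,
Thm. 16.2, Thm. 19.4]
-/

noncomputable section

-- `Summit.<S>.<S>.…` duplicates the summit name by design (single-problem summit).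
set_option linter.dupNamespace false

open Polynomial IsLocalRing

namespace Summit.ResolutionOfSingularities.ResolutionOfSingularities.Theorems.SwitchingDichotomy.SigmaTopLegality

open Literature.AlgebraicGeometry.Resolution

/-! ## §0 The words (VERBATIM `Steer_r31.lean` 727d9e199382098a; only the namespace differs) -/

/-- The local hypersurface ring `S[t]/(t^p − f)` of a radicand `f ∈ S` (the germ of the `t^p = f` torsor). OURS.
(idea-1, verbatim; VERBATIM r31 l.1373) [folklore] -/
abbrev RadicandRing (S : Type) [CommRing S] (p : ℕ) (f : S) : Type :=
  AdjoinRoot (Polynomial.X ^ p - Polynomial.C f)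

variable {K : Type} [Field K]

/-- `Q` is a SINGULAR PRIME of the radicand `f ∈ R`: the torsor germ `R_Q[T]/(T^p − f)` over the local ring of the
base at `Q` is not regular. OURS. (VERBATIM r31 l.1413) [folklore] -/
def IsSingPrime (R : Subring K) (p : ℕ) (f : R) (Q : Ideal R) [Q.IsPrime] : Prop :=
  ¬ IsRegularLocalRing (RadicandRing (Localization.AtPrime Q) p (algebraMap R (Localization.AtPrime Q) f))

/-- `P` is (the generic point of) a TOP-DIMENSIONAL COMPONENT of the singular locus of `T ^ p = f` over the local
base `R`: a singular prime, minimal among singular primes, of maximal dimension `dim R/P` among the minimal singular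
primes. OURS. (VERBATIM r31 l.1420) [folklore] -/
def IsTopSingComponent (R : Subring K) (p : ℕ) (f : R) (P : Ideal R) : Prop :=
  ∃ _ : P.IsPrime, IsSingPrime R p f P ∧
    (∀ (Q : Ideal R) [Q.IsPrime], IsSingPrime R p f Q → Q ≤ P → Q = P) ∧
    (∀ (Q : Ideal R) [Q.IsPrime], IsSingPrime R p f Q →
      (∀ (Q' : Ideal R) [Q'.IsPrime], IsSingPrime R p f Q' → Q' ≤ Q → Q' = Q) →
      ringKrullDim (R ⧸ Q) ≤ ringKrullDim (R ⧸ P))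

/-- A σ_top-PERMISSIBLE positive-dimensional centre for the radicand `f ∈ R` (`R` local): a top singular
component `P ≠ 𝔪_R` which is regular and along which `f` is EQUIMULTIPLE of multiplicity `p` after cleaning
(`f − g^p ∈ P^p`). OURS. (VERBATIM r31 l.1431) [folklore] -/
def IsPermissibleCentre (R : Subring K) [IsLocalRing R] (p : ℕ) (f : R) (P : Ideal R) : Prop :=
  P ≠ maximalIdeal R ∧ IsTopSingComponent R p f P ∧ IsRegularLocalRing (R ⧸ P) ∧ ∃ g : R, f - g ^ p ∈ P ^ p

/-- Stage `i` of the run is a POINT STEP (σ_top found no permissible positive-dimensional centre). OURS.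
(VERBATIM r31 l.1768) [folklore] -/
def IsPointStep (R : ℕ → Subring K) (P : (i : ℕ) → Ideal (R i)) (i : ℕ) : Prop :=
  ∃ _ : IsLocalRing (R i), P i = maximalIdeal (R i)

/-- OURS (strat-2): stage `i` is a POSITIVE-DIMENSIONAL step (the centre is not the closed point).
(VERBATIM r31 l.3090) [folklore] -/
def IsPosStep (R : ℕ → Subring K) (P : (i : ℕ) → Ideal (R i)) (i : ℕ) : Prop :=
  ∃ _ : IsLocalRing (R i), P i ≠ IsLocalRing.maximalIdeal (R i)

/-- OURS (strat-2): ANCESTOR relation of the centre forest — `i < j`, both positive-dimensional, `P j` contracts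
onto `P i` (`comap` along `R i ≤ R j`) and the heights agree. (VERBATIM r31 l.3096) [folklore] -/
def IsAncestorStep (R : ℕ → Subring K) (P : (i : ℕ) → Ideal (R i)) (i j : ℕ) : Prop :=
  i < j ∧ IsPosStep R P i ∧ IsPosStep R P j ∧ (P j).height = (P i).height ∧
    ∃ h : R i ≤ R j, Ideal.comap (Subring.inclusion h) (P j) = P i

/-- OURS (strat-2): a BIRTH — a positive-dimensional step with no ancestor (a root of the centre forest).
(VERBATIM r31 l.3101) [folklore] -/
def IsRootStep (R : ℕ → Subring K) (P : (i : ℕ) → Ideal (R i)) (j : ℕ) : Prop :=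
  IsPosStep R P j ∧ ∀ i, ¬ IsAncestorStep R P i j

/-- OURS (strat-2): infinitely many BIRTHS. (VERBATIM r31 l.3113) [folklore] -/
def HasInfiniteBirths (R : ℕ → Subring K) (P : (i : ℕ) → Ideal (R i)) : Prop :=
  {j | IsRootStep R P j}.Infinite

/-! ## §1 (L1) At `p = 2`: singular regular prime ⇒ equimultiple after cleaning (words-level restatement of
res-type-082's `AutoPermissible.exists_sub_sq_mem_sq_of_singular_atPrime`, p505361) -/

section L1

variable [CharP K 2]

/-- **(L1a)** For a field `K` of characteristic `2`, a regular local subring `R ⊆ K`, `f ∈ R` and a prime `P` with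
`R ⧸ P` regular: if `P` is a SINGULAR PRIME of `T² = f` (`IsSingPrime R 2 f P`) then `f − g² ∈ P²` for some `g ∈ R`.
One-line restatement of `AutoPermissible.exists_sub_sq_mem_sq_of_singular_atPrime` (res-type-082) over the r31
word. [cite: Matsumura1987, Thm. 14.2, Thm. 16.2, Thm. 19.4] -/
theorem exists_sub_sq_mem_sq_of_isSingPrime (R : Subring K) [IsRegularLocalRing R] (f : R) (P : Ideal R)
    [P.IsPrime] (hsing : IsSingPrime R 2 f P) (hreg : IsRegularLocalRing (R ⧸ P)) :
    ∃ g : R, f - g ^ 2 ∈ P ^ 2 :=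
  AutoPermissible.exists_sub_sq_mem_sq_of_singular_atPrime K R f P hreg hsing

/-- **(L1b) = res-L0-w41-plan-1 RULING 52 (L1) / res-L0-w41-tri-3 N-σ1**: at `p = 2`, clauses 2–3 of
`IsPermissibleCentre` (`IsTopSingComponent R 2 f P ∧ IsRegularLocalRing (R ⧸ P)`) IMPLY clause 4
(`∃ g, f − g ^ 2 ∈ P ^ 2`), for a regular local member `R`. Only the «singular prime» part of `IsTopSingComponent`
is used. [cite: Matsumura1987, Thm. 14.2, Thm. 16.2, Thm. 19.4] -/
theorem exists_sub_sq_mem_sq_of_isTopSingComponent (R : Subring K) [IsRegularLocalRing R] (f : R)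
    (P : Ideal R) (hTop : IsTopSingComponent R 2 f P) (hreg : IsRegularLocalRing (R ⧸ P)) :
    ∃ g : R, f - g ^ 2 ∈ P ^ 2 := by
  obtain ⟨_, hsing, -, -⟩ := hTop
  exact exists_sub_sq_mem_sq_of_isSingPrime R f P hsing hreg

/-- **(L1c)** At `p = 2` the equimultiplicity clause of `IsPermissibleCentre` is REDUNDANT for a regular local
member: a σ_top-permissible centre is exactly a top singular component `≠ 𝔪` with regular quotient. (Words-level
form of res-type-082's `AutoPermissible.isPermissibleCentre_two_iff`.) [cite: Matsumura1987, Thm. 14.2] -/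
theorem isPermissibleCentre_two_iff (R : Subring K) [IsRegularLocalRing R] (f : R) (P : Ideal R) :
    IsPermissibleCentre R 2 f P ↔
      P ≠ maximalIdeal R ∧ IsTopSingComponent R 2 f P ∧ IsRegularLocalRing (R ⧸ P) := by
  refine ⟨fun ⟨h1, h2, h3, _⟩ => ⟨h1, h2, h3⟩, fun ⟨h1, h2, h3⟩ => ⟨h1, h2, h3, ?_⟩⟩
  exact exists_sub_sq_mem_sq_of_isTopSingComponent R f P h2 h3

/-- **(L1d) When σ_top takes the POINT step at `p = 2`** (for a regular local member): there is NO permissible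
positive-dimensional centre iff every top singular component other than `𝔪` has a SINGULAR quotient `R ⧸ P`.
(res-L0-w41-tri-3 N-σ1: «σ_top takes the point step iff clord ≥ 2 and no top-dimensional component of Sing is
regular» — this is the second conjunct; the first is the multiplicity clause of `IsSigmaTopCentre` at `𝔪`.)
[cite: Matsumura1987, Thm. 14.2] -/
theorem not_exists_isPermissibleCentre_two_iff (R : Subring K) [IsRegularLocalRing R] (f : R) :
    (∀ Q : Ideal R, ¬ IsPermissibleCentre R 2 f Q) ↔
      ∀ Q : Ideal R, IsTopSingComponent R 2 f Q → Q ≠ maximalIdeal R → ¬ IsRegularLocalRing (R ⧸ Q) := by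
  refine ⟨fun h Q hTop hQ hreg => h Q ((isPermissibleCentre_two_iff R f Q).mpr ⟨hQ, hTop, hreg⟩),
    fun h Q hperm => ?_⟩
  obtain ⟨hQ, hTop, hreg⟩ := (isPermissibleCentre_two_iff R f Q).mp hperm
  exact h Q hTop hQ hreg

end L1

/-! ## §5 (L5) «No two odd boundary components» (res-L0-w41-tri-1 PREREG-FB v1 D·S2, kernel text
`L/res-L0-w41-tri-1/v66/NoTwoOdd.lean` 23645b43a53db55b, offered as a brick for this file and landed here; proofs
tri-1's, namespace changed) -/

section L5

variable {A : Type*} [CommRing A]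

/-- `(xa) ∩ ((xb) + (xa²)) ⊆ (xa)·(xa, xb)` for `xa` prime with `xa ∤ xb`, in equation form. OURS (res-L0-w41-tri-1).
[folklore] -/
theorem mul_mem_span_mul_span_pair {xa xb c d e : A} (hpa : Prime xa) (hndvd : ¬ xa ∣ xb)
    (h : xa * c = xb * d + xa ^ 2 * e) :
    xa * c ∈ Ideal.span {xa} * Ideal.span {xa, xb} := by
  have hdvd : xa ∣ xb * d := ⟨c - xa * e, by linear_combination -h⟩
  obtain ⟨d', rfl⟩ := (hpa.dvd_or_dvd hdvd).resolve_left hndvd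
  have hrew : xa * c = xa * (xb * d' + xa * e) := by linear_combination h
  rw [hrew]
  refine Ideal.mul_mem_mul (Ideal.mem_span_singleton_self xa) ?_
  refine Ideal.add_mem _ ?_ ?_
  · exact Ideal.mul_mem_right _ _ (Ideal.subset_span (by simp))
  · exact Ideal.mul_mem_right _ _ (Ideal.subset_span (by simp))

/-- **No two odd components** (ring form). In characteristic `2`, `f ≡ □ (mod xa)` and `f ≡ □ (mod xb)` with `xa`
prime, `xa ∤ xb`, `(xa, xb)` radical, force `f - ga ^ 2 ∈ (xa)·(xa, xb)`. OURS (res-L0-w41-tri-1). [folklore] -/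
theorem sub_sq_mem_span_mul_span_pair [CharP A 2] {xa xb f ga gb : A} (hpa : Prime xa)
    (hndvd : ¬ xa ∣ xb) (hrad : (Ideal.span {xa, xb}).IsRadical)
    (ha : f - ga ^ 2 ∈ Ideal.span {xa}) (hb : f - gb ^ 2 ∈ Ideal.span {xb}) :
    f - ga ^ 2 ∈ Ideal.span {xa} * Ideal.span {xa, xb} := by
  have h2 : (2 : A) = 0 := by
    have := CharP.cast_eq_zero A 2
    simpa using this
  -- `(ga - gb)² = (f - gb²) - (f - ga²)` in characteristic 2, so it lies in `(xa, xb)`.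
  have hsq : (ga - gb) ^ 2 = (f - gb ^ 2) - (f - ga ^ 2) := by
    linear_combination (gb * (gb - ga)) * h2
  have hPsq : (ga - gb) ^ 2 ∈ Ideal.span {xa, xb} := by
    rw [hsq]
    refine Ideal.sub_mem _ ?_ ?_
    · exact Ideal.span_mono (Set.singleton_subset_iff.2 (by simp)) hb
    · exact Ideal.span_mono (Set.singleton_subset_iff.2 (by simp)) ha
  have hP : ga - gb ∈ Ideal.span {xa, xb} := hrad ⟨2, hPsq⟩
  obtain ⟨α, β, hαβ⟩ := Ideal.mem_span_pair.1 hP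
  obtain ⟨c, hc⟩ := Ideal.mem_span_singleton'.1 ha
  obtain ⟨d, hd⟩ := Ideal.mem_span_singleton'.1 hb
  -- `f - ga² = xb·(d - β² xb) + xa²·(-α²)` using `2 = 0`.
  have key : xa * c = xb * (d - β ^ 2 * xb) + xa ^ 2 * (-(α ^ 2)) := by
    linear_combination hc - hd + (α * xa + β * xb + (ga - gb)) * hαβ
      + (gb * (gb - ga) - α * β * xa * xb) * h2
  have hmem := mul_mem_span_mul_span_pair hpa hndvd key
  have hc' : f - ga ^ 2 = xa * c := by linear_combination -hc
  rw [hc']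
  exact hmem

/-- Corollary: `f - ga ^ 2 ∈ (xa, xb)²`. OURS (res-L0-w41-tri-1). [folklore] -/
theorem sub_sq_mem_span_pair_sq [CharP A 2] {xa xb f ga gb : A} (hpa : Prime xa)
    (hndvd : ¬ xa ∣ xb) (hrad : (Ideal.span {xa, xb}).IsRadical)
    (ha : f - ga ^ 2 ∈ Ideal.span {xa}) (hb : f - gb ^ 2 ∈ Ideal.span {xb}) :
    f - ga ^ 2 ∈ Ideal.span {xa, xb} ^ 2 := by
  have h := sub_sq_mem_span_mul_span_pair hpa hndvd hrad ha hb
  rw [pow_two]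
  refine Ideal.mul_mono_left ?_ h
  exact Ideal.span_mono (Set.singleton_subset_iff.2 (by simp))

/-- **(L5) in the r31 words**: at `p = 2`, on a regular local member `R ⊆ K`, two boundary components `V(xa)`,
`V(xb)` (`xa` prime, `xa ∤ xb`, `(xa, xb)` a radical — e.g. prime — ideal) modulo EACH of which the radicand `f` is
a square («two ODD components») make the codimension-2 stratum `P = (xa, xb)` a SINGULAR PRIME of `T² = f`
(`IsSingPrime R 2 f P`, via res-type-082's `AutoPermissible.singular_atPrime_of_sub_pow_mem_sq`). With `R ⧸ P`
regular, `P ≠ 𝔪` and `P` top-dimensional in the singular locus, `P` is then σ_top-PERMISSIBLE by §1 — σ_top does not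
take the point step there (res-L0-w41-tri-1 PREREG-FB D·S2). [cite: Matsumura1987, Thm. 14.2] -/
theorem isSingPrime_span_pair_of_sq_mod_both [CharP K 2] (R : Subring K) [IsRegularLocalRing R]
    (f xa xb ga gb : R) (hpa : Prime xa) (hndvd : ¬ xa ∣ xb)
    (hrad : (Ideal.span ({xa, xb} : Set R)).IsRadical)
    (ha : f - ga ^ 2 ∈ Ideal.span {xa}) (hb : f - gb ^ 2 ∈ Ideal.span {xb})
    [(Ideal.span ({xa, xb} : Set R)).IsPrime] :
    IsSingPrime R 2 f (Ideal.span ({xa, xb} : Set R)) :=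
  AutoPermissible.singular_atPrime_of_sub_pow_mem_sq K 2 R f (Ideal.span ({xa, xb} : Set R))
    (sub_sq_mem_span_pair_sq hpa hndvd hrad ha hb)

end L5

end Summit.ResolutionOfSingularities.ResolutionOfSingularities.Theorems.SwitchingDichotomy.SigmaTopLegality

end
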